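/-
Origin: expansion seat `planner-pub-hodgecm-pv10-g4-0`, handover #2 2026-08-18T10:35:25Z (`HOME/pub-hodgecm-pv10-g4/lean/Pv10g4/HermSpace3Compact.lean`, md5 db763c64, 77 lines);
landed by the gen-7 packager in gate run 28 as `HodgeCM/Proofs/LandherrCompact.lean` (import ^import Pv[0-9]+g[0-9]+\.→import HodgeCM.PerL34. ×1; stripped 2 #print/#check/#eval lines).
-/
/-
Origin: pub-hodgecm cell, seat pv10-g4 (unit `pub-hodgecm-pv10-g4`, DAG-node prover #10, gen 4), 2026-08-18.
WIP module `Pv10g4.HermSpace3Compact`; intended landing place `HodgeCM/Proofs/LandherrCompact.lean`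
(packager import rewrite: `^import Pv10g4\.GodementCriterion` ↦ `import HodgeCM.PerL34.GodementCriterion`;
the second import is a tree module).
-/
import Summits.HodgeConjecture.HodgeCM.PerL34.GodementCriterion
import Summits.HodgeConjecture.HodgeCM.Proofs.LandherrIsotropy

/-!
# PerL's `[G_U]` is compact iff `[L:ℚ] ≠ 2`

PerL v5 ll. 68–69: "`G_U` is anisotropic and `[G_U] := G_U(L₀)\G_U(𝔸_{L₀})` is compact", for the unitary
group `G_U = U(V₃, h)` of a `V : HermSpace3 L ι₁` (Gram matrix `V.Hm`, hermitian of signature `(2,1)` at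
`ι₁` and definite at the other places).  `Proofs/LandherrIsotropy` (landherr-g9) decided isotropy of `h`
by the degree (`HermSpace3.isIsotropic_iff_finrank_eq_two`: isotropic iff `L` is imaginary quadratic),
and `PerL34/GodementCriterion` (pv10-g4) proves Godement's criterion for `U(H)` in both directions
(`HodgeCM.adelicQuotientCompact_iff_isAnisotropic`).  Composing the two with `HermSpace3.det_ne_zero`
(`Proofs/LandherrHermSpace3`):

* `HermSpace3.adelicQuotientCompact_iff_finrank_ne_two` — **`[G_U]` is compact iff `[L:ℚ] ≠ 2`**; so
  PerL's sentence holds throughout PerL's regime (`[L:ℚ] ≥ 4`, `adelicQuotientCompact_of_two_le_halfDegree`)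
  and FAILS for an imaginary quadratic `L` (`not_adelicQuotientCompact_of_finrank_eq_two`).

Pure composition of landed / handed kernel theorems; nothing cited or posited; closures are the standard trio.
-/

set_option autoImplicit false

open Literature.AlgebraicGeometry.ShimuraVarieties

namespace HodgeCM.HermSpace3

variable {L : CMField} {ι₁ : L →+* ℂ}

/-- `V.Hm` is anisotropic (package sense `IsAnisotropic`) iff `(V₃, h)` is not isotropic
(`HermSpace3.IsIsotropic`, `Proofs/LandherrIsotropy`). -/
theorem isAnisotropic_iff_not_isIsotropic (V : HermSpace3 L ι₁) :
    IsAnisotropic L V.Hm ↔ ¬ V.IsIsotropic := by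
  constructor
  · rintro ha ⟨x, hx, hxx⟩
    exact hx (ha x hxx)
  · intro h x hxx
    by_contra hx
    exact h ⟨x, hx, hxx⟩

/-- `(V₃, h)` is anisotropic iff `[L:ℚ] ≠ 2`. -/
theorem isAnisotropic_iff_finrank_ne_two (V : HermSpace3 L ι₁) :
    IsAnisotropic L V.Hm ↔ Module.finrank ℚ L ≠ 2 := by
  rw [isAnisotropic_iff_not_isIsotropic, isIsotropic_iff_finrank_eq_two]

/-- **PerL v5 ll. 68–69 decided by the degree (KERNEL).**  For every `V : HermSpace3 L ι₁` over a CM field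
`L`, the adelic quotient `[G_U] = U(V.Hm)(L⁺)\U(V.Hm)(𝔸_{L⁺})` is compact if and only if `[L:ℚ] ≠ 2`. -/
theorem adelicQuotientCompact_iff_finrank_ne_two (V : HermSpace3 L ι₁) :
    AdelicQuotientCompact L V.Hm ↔ Module.finrank ℚ L ≠ 2 := by
  rw [HodgeCM.adelicQuotientCompact_iff_isAnisotropic L 3 V.Hm V.isHermitian V.det_ne_zero,
    isAnisotropic_iff_finrank_ne_two]

/-- `[G_U]` is compact as soon as `L` is not imaginary quadratic. -/
theorem adelicQuotientCompact_of_finrank_ne_two (V : HermSpace3 L ι₁) (hL : Module.finrank ℚ L ≠ 2) :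
    AdelicQuotientCompact L V.Hm :=
  (adelicQuotientCompact_iff_finrank_ne_two V).2 hL

/-- `[G_U]` is compact in PerL's regime `g = [L:ℚ]/2 ≥ 2`. -/
theorem adelicQuotientCompact_of_two_le_halfDegree (V : HermSpace3 L ι₁) (hg : 2 ≤ L.halfDegree) :
    AdelicQuotientCompact L V.Hm :=
  adelicQuotientCompact_of_finrank_ne_two V (CMField.finrank_ne_two_of_two_le_halfDegree hg)

/-- **Sharpness**: over an imaginary quadratic `L`, `[G_U]` is NOT compact (`h` is isotropic there). -/
theorem not_adelicQuotientCompact_of_finrank_eq_two (V : HermSpace3 L ι₁)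
    (hL : Module.finrank ℚ L = 2) : ¬ AdelicQuotientCompact L V.Hm :=
  fun hc => (adelicQuotientCompact_iff_finrank_ne_two V).1 hc hL

end HodgeCM.HermSpace3

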